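import Literature.NumberTheory.Rogawski1990.OneDimAutRepH
import Literature.NumberTheory.GaloisRepresentations.HeckeCharacterArchType
import HarnessLib

/-!
# [Rogawski1990 §12.3, Prop. 15.2.1 (b), §14.6] `XiArchPinned L ξ μω k` — the ARCHIMEDEAN PIN of a one-dimensional automorphic `ξ` of
# `H = U(2) × U(1)` relative to Rogawski's auxiliary character `μω`, and Rogawski's parameter `t` read off the archimedean type of `μω`

Topic `NumberTheory/Rogawski1990`; namespace `Literature.NumberTheory.Rogawski1990`.  VOCABULARY ONLY: two definitions with bodies
(`ArchSignRecipe.tOfArchType`, `XiArchPinned`) and two unfolding theorems; **no named fact, no `sorry`, no instance, no notation** — net debt 0.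
Cell `hodgecm-mathlib` (D-0151), FLOOR 0, crux H413: the predicate programme P3's S2♯ letter exports as the T5 v4 head conjunct (C4∞)
(F0P3-plan (g4) RULING (V23): «a predicate P2 defines, P3 adopts verbatim») and programme P2's RIG∞″ consumes; text = F0P2-plan (g6)'s
spec `F0/P2/XiArchPinned.spec.F0P2-plan-g6.lean` (sha16 26473ad327bf3dde), declarations byte-identical.  EDITION 2 (2026-08-31, F0-typ1 (g5)):
DOCSTRING-ONLY — page digits of the Rogawski locators per the cite desk (lit1 D-CITE #21 (215): §14.6 opens p. 241, Prop. 15.2.1 (b) is on p. 249);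
every declaration byte-identical to edition 1 (p818382).  HONEST LABEL: HC_CM is proved only modulo the printed citations until rung 0 closes; this
file asserts nothing.

CURRENCY.  `μω.HasUnitaryArchType k 0` (★ `HeckeCharacter.HasUnitaryArchType`, Mathlib's `ι_w = w.embedding`):
`μω_w(z) = (ι_w z/|ι_w z|)^{k_w}`, `k_w` odd (★ `IsSplittingChar.exists_hasUnitaryArchType` for `μω|_{𝕀_{L⁺}} = ω_{L/L⁺}`).
Rogawski's parameter `t` at an EMBEDDING `ι` over `w` (`μ_ι(z) = (z/z̄)^{t+1/2} = (ι z/|ι z|)^{2t+1}`, [Rogawski1990, §12.3 p. 174]):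
`2t+1 = k_w` if `ι = ι_w`, `2t+1 = −k_w` if `ι = ῑ_w` — i.e. `2t + 1 = −expAt k ι` (★ `OneDimAutRepH.expAt`, whose sign convention is
`u ↦ ι(u)^{expAt e ι}` for the torus types where `η_arch_apply` carries `−e_w`); so `t = (−expAt k ι − 1)/2` (exact division, `k_w` odd),
and `t ↦ −t−1` under `ι ↦ ῑ` as in ★ `ArchSignRecipe` (`expAt_conjugate`).

THE PIN.  At EVERY complex embedding `ι` the archimedean component `ξ_ι` is of cohomological type for trivial coefficients:
★ `ξ.IsCohTrivialAt t ι` (`rogTriple (ξ.pη ι) (ξ.qψ ι) t = (1,0,−1)`, i.e. `(q, p+t) ∈ {(1,−2), (−1,1)}`) — at the non-compact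
embedding this is [Rogawski1990, Prop. 15.2.1 (b) p. 249, §12.3 p. 178] (`P_ι ∈ {J⁺_φ, J⁻_φ}`, `φ = φ(1,0,−1)`), at a compact embedding it
is «`P_τ = 𝟙 ∈ Π′(ξ_τ)` ⇒ `F_φ = 𝟙` ⇒ `(a,b,c) = (1,0,−1)`» [Rogawski1990, §14.6 p. 241; §12.3 p. 176].

TEST-∞ (by hand, both cases, every odd `k_w`; recorded for the consumers, NOT asserted): under the pin, `ξ.bcη⁻¹ · ξ.bcψ⁻¹ · μω` has
unitary type `k_w − 2·eη_w − 2·eψ_w = −1` (`+` case) ∕ `+1` (`−` case) ⇒ WEIGHT ONE; and `ξ.bcψ · (ξ.bcη⁻¹ξ.bcψ⁻¹μω)⁻²` has type `0`.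

## References
* [Rogawski1990] J. Rogawski, *Automorphic representations of unitary groups in three variables*, Ann. of Math. Stud. 123 (1990): §12.3
  pp. 174–178 (the archimedean packets `Π(φ)`, `J^±_φ`, the parameter `t`; Prop. 12.3.3–Cor. 12.3.5 p. 178), §14.6 p. 241 (heading
  «14.6 The global correspondence», Thm. 14.6.1), Prop. 15.2.1 (b) p. 249.
-/

set_option autoImplicit false

noncomputable section

open NumberField

namespace Literature.NumberTheory.Rogawski1990

open Literature.NumberTheory.GaloisRepresentations

/-- **Rogawski's parameter `t` of `μω` at the embedding `ι`** from the unitary archimedean type `k` of `μω`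
(`μ_ι(z) = (z/z̄)^{t+1/2}`, `2t + 1 = −expAt k ι`). [cite: Rogawski1990, §12.3 p. 174] -/
def ArchSignRecipe.tOfArchType {L : Type} [Field L] [NumberField L] [IsCMField L] (k : InfinitePlace L → ℤ) (ι : L →+* ℂ) : ℤ :=
  (-OneDimAutRepH.expAt k ι - 1) / 2

/-- **`XiArchPinned L ξ μω k` — the archimedean pin of `ξ` relative to `μω`** (S2♯'s archimedean conjunct): `μω` has the odd
unitary archimedean type `k`, and at every complex embedding `ι` of `L` the component `ξ_ι` is of cohomological type for trivial
coefficients w.r.t. Rogawski's parameter `t = (−expAt k ι − 1)/2` of `μω` at `ι`.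
[cite: Rogawski1990, Prop. 15.2.1 (b) p. 249; §12.3 pp. 174–178; §14.6 p. 241] -/
def XiArchPinned (L : Type) [Field L] [NumberField L] [IsCMField L] (ξ : OneDimAutRepH L) (μω : HeckeCharacter L)
    (k : InfinitePlace L → ℤ) : Prop :=
  μω.HasUnitaryArchType k (fun _ => 0) ∧ (∀ w : InfinitePlace L, Odd (k w)) ∧
    ∀ ι : L →+* ℂ, ξ.IsCohTrivialAt (ArchSignRecipe.tOfArchType k ι) ι

/-- Unfolding. [cite: Rogawski1990, Prop. 15.2.1 (b)] -/
theorem xiArchPinned_iff (L : Type) [Field L] [NumberField L] [IsCMField L] (ξ : OneDimAutRepH L) (μω : HeckeCharacter L)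
    (k : InfinitePlace L → ℤ) :
    XiArchPinned L ξ μω k ↔
      μω.HasUnitaryArchType k (fun _ => 0) ∧ (∀ w : InfinitePlace L, Odd (k w)) ∧
        ∀ ι : L →+* ℂ, ξ.IsCohTrivialAt (ArchSignRecipe.tOfArchType k ι) ι :=
  Iff.rfl

/-- **The pin in exponents** (★ `isCohTrivial_iff`, no division): at each `ι`, with `p = ξ.pη ι`, `q = ξ.qψ ι`, `x = expAt k ι`:
`(q = 1 ∧ 2p − x = −3) ∨ (q = −1 ∧ 2p − x = 3)`. [cite: Rogawski1990, §12.3 p. 178] -/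
theorem isCohTrivialAt_tOfArchType_iff {L : Type} [Field L] [NumberField L] [IsCMField L] (ξ : OneDimAutRepH L)
    (k : InfinitePlace L → ℤ) (hk : ∀ w : InfinitePlace L, Odd (k w)) (ι : L →+* ℂ) :
    ξ.IsCohTrivialAt (ArchSignRecipe.tOfArchType k ι) ι ↔
      (ξ.qψ ι = 1 ∧ 2 * ξ.pη ι - OneDimAutRepH.expAt k ι = -3) ∨
        (ξ.qψ ι = -1 ∧ 2 * ξ.pη ι - OneDimAutRepH.expAt k ι = 3) := by
  have hodd : Odd (OneDimAutRepH.expAt k ι) := by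
    unfold OneDimAutRepH.expAt
    split_ifs <;> simp [hk]
  obtain ⟨m, hm⟩ := hodd
  unfold OneDimAutRepH.IsCohTrivialAt ArchSignRecipe.tOfArchType
  rw [ArchSignRecipe.isCohTrivial_iff, hm]
  have h2 : (-(2 * m + 1) - 1) / 2 = -m - 1 := by omega
  rw [h2]
  omega

end Literature.NumberTheory.Rogawski1990

end
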